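import Mathlib
import Summits.NavierStokesRegularity.NavierStokesRegularity.Theorems.TaoLadderRungTwoBreakBlowupRigidityOneEnergyBound
import Summits.NavierStokesRegularity.NavierStokesRegularity.Theorems.TaoLadderRungTwoBreakBlowupRigidityOneMaximalExactFlow
import HarnessLib

/-!
# ENERGY INEQUALITY for the VISCOUS cascade flow of a cancelling table (`ν ≥ 0`): the partial energies
  `Σ_{k ≤ K} ‖x_k(t)‖²` never exceed the datum energy `Σ_i X₀ᵢ²`, hence `|X_{i,k}(t)| ≤ ‖X₀‖` along every
  maximal `ν`-viscous flow of `maximalViscousFlow_of_noGlobalCascade` — companion of `…EnergyBound`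
  (`ν = 0`) for the viscous trajectories of K2ᵛ(1) ⟨20420⟩/⟨22743⟩ (support for stmt-NavierStokesRegularity-20206)

MODEL lattice ODEs only (Tao 2016 §4 (4.3) and the viscous equation before Thm. 4.2: the energy identity
`d/dt E = -2ν Σ (1+ε₀)^{2k}‖x_k‖² ≤ 0` up to the top flux); nothing here is a statement about the
Navier–Stokes equations; NO item is closed (`--supports stmt-NavierStokesRegularity-20206`). Route-independent;
general `m`; only the flow clauses are assumed (no `ViscousGlobal`, no `Pinned`).

* `viscousShellEnergy_hasDerivWithinAt` — `d/dt ‖x_k‖² = f_{k-1} - f_k - 2ν(1+ε₀)^{2k}‖x_k‖²`;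
* `viscousPartialEnergy_le_datumEnergy` — `Σ_{k=0}^{K} ‖x_k(t)‖² ≤ Σ_i X₀ᵢ²` for every `t < T`, `K`
  (one-sided comparison `image_le_of_deriv_right_le_deriv_boundary` with `E₀ + C q^{K'} t`, `K' → ∞`);
* `viscous_abs_le_datumNorm` — `|X_{i,k}(t)| ≤ √(Σ_i X₀ᵢ²)`;
* `viscousHighShellBlowup_of_noGlobalCascade` — robust blow-up ⇒ for EVERY viscosity `0 ≤ ν ≤ κ/√2` the
  maximal `ν`-viscous flow (`maximalViscousFlow_of_noGlobalCascade`) blows up in the (4.5) norm ON SHELLS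
  `k → ∞`: for every `K`, `L` some `t < T⋆`, mode `i` and shell `k > K` have `(1+(1+ε₀)^{10k})|X_{i,k}(t)| > L`
  (the low shells are bounded by `(1+(1+ε₀)^{10K})‖X₀‖`).
-/

noncomputable section

-- the summit and its single sub-problem share the name (CONVENTIONS §1)
set_option linter.dupNamespace false

open Set Filter Topology Finset
open scoped RealInnerProductSpace

namespace Summit.NavierStokesRegularity.NavierStokesRegularity.Theorems

namespace BlowupRigidityOne

open Literature.Analysis.FluidPDE Literature.Analysis.FluidPDE.TaoCascade
open DSSOneShift (hasDerivWithinAt_shellVec shellVec_quadTerm_normalForm norm_shellVec_le_sqrt_mul)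

variable {m : ℕ}

/-- **Per-shell energy balance of a VISCOUS flow of a cancelling table**:
`d/dt ‖x_k(t)‖² = f_{k-1} - f_k - 2ν(1+ε₀)^{2k}‖x_k‖²`, `f_k = 2Λ^k⟪x_{k+1}, A(x_k)⟫`, from the one-sided law
`HasDerivWithinAt (X i k) (quadTerm_{i,k}(X)(t) - ν(1+ε₀)^{2k}X_{i,k}(t)) [0,∞) t` of every component.
[cite: Tao2016AveragedNS, §4 (4.3) and the viscous equation before Thm. 4.2] -/
theorem viscousShellEnergy_hasDerivWithinAt {ε₀ ν : ℝ} (hε : 0 < ε₀)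
    {α : Fin m → Fin m → Fin m → ℤ × ℤ × ℤ → ℝ} (hc : IsCancellingCoeff α)
    {X : Fin m → ℤ → ℝ → ℝ} {k : ℤ} {t : ℝ}
    (hder : ∀ i, HasDerivWithinAt (X i k)
      (quadTerm ε₀ α X i k t - ν * (1 + ε₀) ^ ((2 : ℝ) * k) * X i k t) (Ici 0) t) :
    HasDerivWithinAt (fun s => ‖shellVec X k s‖ ^ 2)
      (2 * bigLam ε₀ ^ (k - 1) * ⟪shellVec X k t, tableA α (shellVec X (k - 1) t)⟫
        - 2 * bigLam ε₀ ^ k * ⟪shellVec X (k + 1) t, tableA α (shellVec X k t)⟫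
        - 2 * (ν * (1 + ε₀) ^ ((2 : ℝ) * k)) * ‖shellVec X k t‖ ^ 2) (Ici 0) t := by
  have hL : 0 < bigLam ε₀ := bigLam_pos (by linarith)
  have hS := table_sTable α hc
  have hv : HasDerivWithinAt (shellVec X k)
      (WithLp.toLp 2 fun i => quadTerm ε₀ α X i k t - ν * (1 + ε₀) ^ ((2 : ℝ) * k) * X i k t) (Ici 0) t :=
    hasDerivWithinAt_shellVec hder
  have heq : (WithLp.toLp 2 fun i => quadTerm ε₀ α X i k t - ν * (1 + ε₀) ^ ((2 : ℝ) * k) * X i k t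
      : Em m) = shellVec (fun i n s => quadTerm ε₀ α X i n s) k t
        - (ν * (1 + ε₀) ^ ((2 : ℝ) * k)) • shellVec X k t := by
    ext i
    simp [shellVec, smul_eq_mul]
  rw [heq, shellVec_quadTerm_normalForm (by linarith) α X k t] at hv
  refine hv.norm_sq.congr_deriv ?_
  rw [inner_sub_right, real_inner_smul_right, inner_add_right, inner_add_right, real_inner_smul_right,
    hS.intra, real_inner_smul_right, real_inner_self_eq_norm_sq]
  have hcan := hS.cancel (shellVec X k t) (shellVec X (k + 1) t)
  rw [zpow_sub_one₀ hL.ne']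
  linear_combination (2 * bigLam ε₀ ^ k) * hcan

/-- **VISCOUS ENERGY INEQUALITY.** `ε₀ > 0`, `ν ≥ 0`, `α` cancelling; `X` a `ν`-viscous flow on `[0,T)` from
the one-shell datum `X₀` at shell `0` (derivatives within `[0,∞)`, no shells below `0`, (4.5)-regular on
every `[0,T']`, `T' < T`). Then `Σ_{k=0}^{K} ‖x_k(t)‖² ≤ Σ_i X₀ᵢ²` for all `t ∈ [0,T)` and all `K`.
[cite: Tao2016AveragedNS, §4 (4.3), Lemma 4.1 (4.5), and the viscous equation before Thm. 4.2] -/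
theorem viscousPartialEnergy_le_datumEnergy {ε₀ ν T : ℝ} (hε : 0 < ε₀) (hν : 0 ≤ ν)
    {α : Fin m → Fin m → Fin m → ℤ × ℤ × ℤ → ℝ} (hc : IsCancellingCoeff α)
    {X : Fin m → ℤ → ℝ → ℝ} {X₀ : Fin m → ℝ}
    (hder : ∀ i k, ∀ t ∈ Ico 0 T, HasDerivWithinAt (X i k)
      (quadTerm ε₀ α X i k t - ν * (1 + ε₀) ^ ((2 : ℝ) * k) * X i k t) (Ici 0) t)
    (hinit : ∀ i k, X i k 0 = if k = 0 then X₀ i else 0)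
    (hlow : ∀ i k t, k < 0 → X i k t = 0)
    (hreg : ∀ T' : ℝ, T' < T → ∃ M : ℝ, ∀ t ∈ Icc 0 T', ∀ (i : Fin m) (k : ℤ),
      (1 + (1 + ε₀) ^ ((10 : ℝ) * k)) * |X i k t| ≤ M) :
    ∀ t ∈ Ico 0 T, ∀ K : ℕ,
      ∑ k ∈ Finset.range (K + 1), ‖shellVec X (k : ℤ) t‖ ^ 2 ≤ ∑ i, X₀ i ^ 2 := by
  intro t ht K
  have hl0 : (0 : ℝ) < 1 + ε₀ := by linarith
  have hl1 : (1 : ℝ) < 1 + ε₀ := by linarith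
  have hL : 0 < bigLam ε₀ := bigLam_pos (by linarith)
  have hS := table_sTable α hc
  obtain ⟨M₀, hM₀⟩ := hreg t ht.2
  set M : ℝ := max M₀ 0 with hMdef
  have hM : ∀ τ ∈ Icc (0 : ℝ) t, ∀ (i : Fin m) (k : ℤ), (1 + (1 + ε₀) ^ ((10 : ℝ) * k)) * |X i k τ| ≤ M :=
    fun τ hτ i k => (hM₀ τ hτ i k).trans (le_max_left _ _)
  have hM0 : 0 ≤ M := le_max_right _ _
  -- the flux `f k τ = 2 Λ^k ⟪x_{k+1}, A x_k⟫`
  set f : ℤ → ℝ → ℝ := fun k τ =>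
    2 * bigLam ε₀ ^ k * ⟪shellVec X (k + 1) τ, tableA α (shellVec X k τ)⟫ with hfdef
  -- partial energies
  set S : ℕ → ℝ → ℝ := fun K' τ => ∑ k ∈ Finset.range (K' + 1), ‖shellVec X (k : ℤ) τ‖ ^ 2 with hSdef
  -- the shells below `0` vanish, so `f (-1) = 0`
  have hxneg : ∀ τ, shellVec X (-1) τ = 0 := fun τ => by
    ext i; simp [shellVec, hlow i (-1) τ (by norm_num)]
  have hfneg : ∀ τ, f (-1) τ = 0 := fun τ => by
    simp only [hfdef]
    rw [hxneg, tableA_zero hc, inner_zero_right, mul_zero]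
  -- derivative of the partial energy: telescoping
  -- the dissipation of the partial energy: `d k τ = 2 ν (1+ε₀)^{2k} ‖x_k(τ)‖² ≥ 0`
  set d : ℕ → ℝ → ℝ := fun k τ => 2 * (ν * (1 + ε₀) ^ ((2 : ℝ) * ((k : ℤ) : ℝ))) * ‖shellVec X (k : ℤ) τ‖ ^ 2
    with hddef
  have hd0 : ∀ k τ, 0 ≤ d k τ := fun k τ => by
    simp only [hddef]
    have := Real.rpow_nonneg hl0.le ((2 : ℝ) * ((k : ℤ) : ℝ))
    positivity
  have hSder : ∀ K' : ℕ, ∀ τ ∈ Icc (0 : ℝ) t,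
      HasDerivWithinAt (S K') (-(f K' τ) - ∑ k ∈ Finset.range (K' + 1), d k τ) (Ici 0) τ := by
    intro K' τ hτ
    have hτT : τ ∈ Ico (0 : ℝ) T := ⟨hτ.1, lt_of_le_of_lt hτ.2 ht.2⟩
    have hterm : ∀ k ∈ Finset.range (K' + 1), HasDerivWithinAt (fun s => ‖shellVec X (k : ℤ) s‖ ^ 2)
        ((f ((k : ℤ) - 1) τ - f k τ) - d k τ) (Ici 0) τ := by
      intro k _
      have h := viscousShellEnergy_hasDerivWithinAt hε hc (ν := ν) (k := (k : ℤ)) (fun i => hder i k τ hτT)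
      simp only [hfdef, hddef, sub_add_cancel]
      exact h
    have hsum := HasDerivWithinAt.sum hterm
    have htel : ∑ k ∈ Finset.range (K' + 1), ((f ((k : ℤ) - 1) τ - f k τ) - d k τ) =
        -(f K' τ) - ∑ k ∈ Finset.range (K' + 1), d k τ := by
      rw [Finset.sum_sub_distrib]
      have h := Finset.sum_range_sub' (fun k : ℕ => f ((k : ℤ) - 1) τ) (K' + 1)
      have e : ∀ k : ℕ, f (((k + 1 : ℕ) : ℤ) - 1) τ = f (k : ℤ) τ := fun k => by
        congr 1; push_cast; ring
      simp only [e] at h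
      rw [h]
      push_cast
      rw [hfneg, zero_sub]
    rw [htel, Finset.sum_fn] at hsum
    exact hsum
  -- bound on the top flux via the a priori weight
  have hW1 : ∀ k : ℤ, (1 : ℝ) ≤ 1 + (1 + ε₀) ^ ((10 : ℝ) * k) := fun k => by
    linarith [Real.rpow_nonneg hl0.le ((10 : ℝ) * k)]
  have hcomp : ∀ τ ∈ Icc (0 : ℝ) t, ∀ (i : Fin m) (k : ℤ), |X i k τ| ≤ M / (1 + (1 + ε₀) ^ ((10 : ℝ) * k)) :=
    fun τ hτ i k => by
      rw [le_div_iff₀ (lt_of_lt_of_le one_pos (hW1 k)), mul_comm]; exact hM τ hτ i k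
  have hxle : ∀ τ ∈ Icc (0 : ℝ) t, ∀ k : ℤ, ‖shellVec X k τ‖ ≤ Real.sqrt m * (M / (1 + (1 + ε₀) ^ ((10 : ℝ) * k))) :=
    fun τ hτ k => norm_shellVec_le_sqrt_mul (div_nonneg hM0 (lt_of_lt_of_le one_pos (hW1 k)).le)
      (fun i => hcomp τ hτ i k)
  have hxle' : ∀ τ ∈ Icc (0 : ℝ) t, ∀ k : ℤ, ‖shellVec X k τ‖ ≤ Real.sqrt m * M := fun τ hτ k =>
    (hxle τ hτ k).trans (mul_le_mul_of_nonneg_left (div_le_self hM0 (hW1 k)) (Real.sqrt_nonneg _))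
  -- the decay ratio `q = Λ / (1+ε₀)^10 < 1`
  set q : ℝ := bigLam ε₀ / (1 + ε₀) ^ (10 : ℝ) with hqdef
  have hP10 : 0 < (1 + ε₀) ^ (10 : ℝ) := Real.rpow_pos_of_pos hl0 _
  have hq0 : 0 ≤ q := div_nonneg hL.le hP10.le
  have hq1 : q < 1 := by
    rw [hqdef, div_lt_one hP10]
    unfold bigLam
    exact Real.rpow_lt_rpow_of_exponent_lt hl1 (by norm_num)
  set Cf : ℝ := 2 * fluxConst α * (Real.sqrt m * M) ^ 3 with hCfdef
  have hCf0 : 0 ≤ Cf := by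
    have := fluxConst_nonneg α
    positivity
  have hfbound : ∀ K' : ℕ, ∀ τ ∈ Icc (0 : ℝ) t, |f K' τ| ≤ Cf * q ^ K' := by
    intro K' τ hτ
    have hA := hS.normA (shellVec X K' τ)
    have h1 : |⟪shellVec X ((K' : ℤ) + 1) τ, tableA α (shellVec X K' τ)⟫| ≤
        (Real.sqrt m * M) * (fluxConst α * (‖shellVec X (K' : ℤ) τ‖ * ‖shellVec X (K' : ℤ) τ‖)) := by
      refine (abs_real_inner_le_norm _ _).trans ?_
      rw [← sq]
      exact mul_le_mul (hxle' τ hτ _) hA (norm_nonneg _) (by positivity)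
    -- one factor of `‖x_{K'}‖` carries the weight
    have h2 : ‖shellVec X (K' : ℤ) τ‖ * ‖shellVec X (K' : ℤ) τ‖ ≤
        (Real.sqrt m * M) * (Real.sqrt m * (M / (1 + (1 + ε₀) ^ ((10 : ℝ) * ((K' : ℤ) : ℝ))))) :=
      mul_le_mul (hxle' τ hτ _) (hxle τ hτ _) (norm_nonneg _) (by positivity)
    have hW : ((1 + ε₀) ^ (10 : ℝ)) ^ K' ≤ 1 + (1 + ε₀) ^ ((10 : ℝ) * ((K' : ℤ) : ℝ)) := by
      have : ((1 + ε₀) ^ (10 : ℝ)) ^ K' = (1 + ε₀) ^ ((10 : ℝ) * ((K' : ℤ) : ℝ)) := by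
        rw [← Real.rpow_natCast, ← Real.rpow_mul hl0.le]; push_cast; ring_nf
      linarith
    have hW0 : 0 < ((1 + ε₀) ^ (10 : ℝ)) ^ K' := pow_pos hP10 _
    have h3 : M / (1 + (1 + ε₀) ^ ((10 : ℝ) * ((K' : ℤ) : ℝ))) ≤ M / ((1 + ε₀) ^ (10 : ℝ)) ^ K' :=
      div_le_div_of_nonneg_left hM0 hW0 hW
    have hΛK : bigLam ε₀ ^ ((K' : ℤ)) = bigLam ε₀ ^ K' := zpow_natCast _ _
    simp only [hfdef]
    rw [abs_mul, abs_mul, abs_two, hΛK, abs_of_pos (pow_pos hL _)]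
    have hsm : 0 ≤ Real.sqrt m := Real.sqrt_nonneg _
    calc 2 * bigLam ε₀ ^ K' * |⟪shellVec X ((K' : ℤ) + 1) τ, tableA α (shellVec X (K' : ℤ) τ)⟫|
        ≤ 2 * bigLam ε₀ ^ K' * ((Real.sqrt m * M) * (fluxConst α *
            ((Real.sqrt m * M) * (Real.sqrt m * (M / ((1 + ε₀) ^ (10 : ℝ)) ^ K'))))) := by
          refine mul_le_mul_of_nonneg_left (h1.trans ?_) (by positivity)
          refine mul_le_mul_of_nonneg_left (mul_le_mul_of_nonneg_left (h2.trans ?_)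
            (fluxConst_nonneg α)) (by positivity)
          exact mul_le_mul_of_nonneg_left (mul_le_mul_of_nonneg_left h3 hsm) (by positivity)
      _ = Cf * (bigLam ε₀ ^ K' / ((1 + ε₀) ^ (10 : ℝ)) ^ K') := by
          simp only [hCfdef]; field_simp
      _ = Cf * q ^ K' := by rw [hqdef, div_pow]
  -- the partial energy at time `0` is the datum energy
  have hS0 : ∀ K' : ℕ, S K' 0 = ∑ i, X₀ i ^ 2 := by
    intro K'
    simp only [hSdef]
    rw [Finset.sum_eq_single 0]
    · rw [EuclideanSpace.norm_eq, Real.sq_sqrt (Finset.sum_nonneg fun i _ => by positivity)]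
      refine Finset.sum_congr rfl fun i _ => ?_
      simp [shellVec, hinit]
    · intro k _ hk
      have : shellVec X (k : ℤ) 0 = 0 := by
        ext i
        simp [shellVec, hinit, hk]
      rw [this, norm_zero, zero_pow two_ne_zero]
    · intro h; exact absurd (Finset.mem_range.2 (Nat.succ_pos K')) h
  -- one-sided comparison on `[0,t]`: `S K' ≤ E₀ + Cf q^{K'} τ`
  have hSt : ∀ K' : ℕ, S K' t ≤ ∑ i, X₀ i ^ 2 + Cf * q ^ K' * t := by
    intro K'
    have hcont : ContinuousOn (S K') (Icc 0 t) := fun τ hτ =>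
      ((hSder K' τ hτ).continuousWithinAt).mono Icc_subset_Ici_self
    have hderS : ∀ τ ∈ Ico (0 : ℝ) t, HasDerivWithinAt (S K')
        (-(f K' τ) - ∑ k ∈ Finset.range (K' + 1), d k τ) (Ici τ) τ := fun τ hτ =>
      (hSder K' τ ⟨hτ.1, hτ.2.le⟩).mono (Ici_subset_Ici.2 hτ.1)
    have hB : ∀ τ ∈ Ico (0 : ℝ) t, HasDerivWithinAt (fun τ => ∑ i, X₀ i ^ 2 + Cf * q ^ K' * τ)
        (Cf * q ^ K') (Ici τ) τ := fun τ _ => by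
      have h := ((hasDerivAt_id τ).const_mul (Cf * q ^ K')).const_add (∑ i, X₀ i ^ 2)
      rw [mul_one] at h
      exact h.hasDerivWithinAt
    have hcmp := image_le_of_deriv_right_le_deriv_boundary hcont hderS
      (by rw [hS0, mul_zero, add_zero]) (by fun_prop) hB (fun τ hτ => by
        have h1 := hfbound K' τ ⟨hτ.1, hτ.2.le⟩
        have h2 : 0 ≤ ∑ k ∈ Finset.range (K' + 1), d k τ := Finset.sum_nonneg fun k _ => hd0 k τ
        linarith [(abs_le.1 h1).1])
    exact hcmp (right_mem_Icc.2 ht.1)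
  -- let `K' → ∞`
  refine le_of_forall_pos_lt_add fun η hη => ?_
  obtain ⟨N, hN⟩ := exists_pow_lt_of_lt_one (show 0 < η / (Cf * t + 1) from
    div_pos hη (by nlinarith [hCf0, ht.1])) hq1
  set K' := max K N with hK'def
  have hmono : S K t ≤ S K' t := by
    simp only [hSdef]
    exact Finset.sum_le_sum_of_subset_of_nonneg
      (Finset.range_mono (Nat.succ_le_succ (le_max_left K N))) fun _ _ _ => by positivity
  have hqK : q ^ K' ≤ q ^ N := pow_le_pow_of_le_one hq0 hq1.le (le_max_right _ _)
  have hsmall : Cf * q ^ K' * t < η := by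
    have h1 : Cf * q ^ K' * t ≤ Cf * q ^ N * t := by
      have := mul_le_mul_of_nonneg_left hqK hCf0
      exact mul_le_mul_of_nonneg_right this ht.1
    have h2 : Cf * q ^ N * t ≤ (Cf * t + 1) * q ^ N := by nlinarith [pow_nonneg hq0 N, ht.1]
    have h3 : (Cf * t + 1) * q ^ N < η := by
      have := hN
      rwa [lt_div_iff₀ (by nlinarith [hCf0, ht.1]), mul_comm] at this
    linarith
  calc ∑ k ∈ Finset.range (K + 1), ‖shellVec X (k : ℤ) t‖ ^ 2 = S K t := rfl
    _ ≤ S K' t := hmono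
    _ ≤ ∑ i, X₀ i ^ 2 + Cf * q ^ K' * t := hSt K'
    _ < ∑ i, X₀ i ^ 2 + η := by linarith

/-- **Amplitude bound along viscous flows**: under the hypotheses of `viscousPartialEnergy_le_datumEnergy`,
`|X_{i,k}(t)| ≤ √(Σ_j X₀ⱼ²)` on `[0,T)`. [cite: Tao2016AveragedNS, §4 (4.3) and the viscous equation before Thm. 4.2] -/
theorem viscous_abs_le_datumNorm {ε₀ ν T : ℝ} (hε : 0 < ε₀) (hν : 0 ≤ ν)
    {α : Fin m → Fin m → Fin m → ℤ × ℤ × ℤ → ℝ} (hc : IsCancellingCoeff α)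
    {X : Fin m → ℤ → ℝ → ℝ} {X₀ : Fin m → ℝ}
    (hder : ∀ i k, ∀ t ∈ Ico 0 T, HasDerivWithinAt (X i k)
      (quadTerm ε₀ α X i k t - ν * (1 + ε₀) ^ ((2 : ℝ) * k) * X i k t) (Ici 0) t)
    (hinit : ∀ i k, X i k 0 = if k = 0 then X₀ i else 0)
    (hlow : ∀ i k t, k < 0 → X i k t = 0)
    (hreg : ∀ T' : ℝ, T' < T → ∃ M : ℝ, ∀ t ∈ Icc 0 T', ∀ (i : Fin m) (k : ℤ),
      (1 + (1 + ε₀) ^ ((10 : ℝ) * k)) * |X i k t| ≤ M) :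
    ∀ t ∈ Ico 0 T, ∀ (i : Fin m) (k : ℤ), |X i k t| ≤ Real.sqrt (∑ j, X₀ j ^ 2) := by
  intro t ht i k
  rcases lt_or_ge k 0 with hk | hk
  · rw [hlow i k t hk, abs_zero]; exact Real.sqrt_nonneg _
  · obtain ⟨n, rfl⟩ := Int.eq_ofNat_of_zero_le hk
    have hE := viscousPartialEnergy_le_datumEnergy hε hν hc hder hinit hlow hreg t ht n
    have h1 : ‖shellVec X (n : ℤ) t‖ ^ 2 ≤ ∑ k ∈ Finset.range (n + 1), ‖shellVec X (k : ℤ) t‖ ^ 2 :=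
      Finset.single_le_sum (f := fun k : ℕ => ‖shellVec X (k : ℤ) t‖ ^ 2) (fun _ _ => by positivity)
        (Finset.mem_range.2 (Nat.lt_succ_self n))
    have h2 : |X i (n : ℤ) t| ^ 2 ≤ ‖shellVec X (n : ℤ) t‖ ^ 2 := by
      rw [EuclideanSpace.norm_eq, Real.sq_sqrt (Finset.sum_nonneg fun j _ => by positivity)]
      have := Finset.single_le_sum (f := fun j => ‖shellVec X (n : ℤ) t j‖ ^ 2)
        (fun _ _ => by positivity) (Finset.mem_univ i)
      simpa [shellVec, Real.norm_eq_abs] using this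
    rw [← Real.sqrt_sq (abs_nonneg (X i (n : ℤ) t))]
    exact Real.sqrt_le_sqrt (by linarith)

/-- **ROBUST BLOW-UP ⇒ THE VISCOUS BLOW-UPS ESCAPE TO HIGH SHELLS.** If `NoGlobalCascade ε₀ α X₀` (`ε₀ > 0`,
`α ∈ E₂(R)`), there is `κ > 0` such that for every viscosity `0 ≤ ν ≤ κ/√2` the maximal `ν`-viscous flow from
the one-shell datum (clauses of `maximalViscousFlow_of_noGlobalCascade`: `C¹` on `[0,T)`, datum, no shells
below `0`, viscous motion, (4.5)-regular before `T`, (4.5) norm unbounded) has all amplitudes `≤ √(Σ X₀ᵢ²)`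
and realises its (4.5)-norm blow-up on shells `k → ∞`: for every `K` and `L` there are `t < T`, `i`, `k > K`
with `(1+(1+ε₀)^{10k})|X_{i,k}(t)| > L`.
[cite: Tao2016AveragedNS, §4 Thm. 4.2 and the viscous equation before Thm. 4.2; Teschl2012, §2.6] -/
theorem viscousHighShellBlowup_of_noGlobalCascade {ε₀ R : ℝ} (hε : 0 < ε₀)
    {α : Fin m → Fin m → Fin m → ℤ × ℤ × ℤ → ℝ} {X₀ : Fin m → ℝ} (hα : InTableClass R α)
    (hNG : NoGlobalCascade ε₀ α X₀) :
    ∃ κ : ℝ, 0 < κ ∧ ∀ ν : ℝ, 0 ≤ ν → ν * Real.sqrt 2 ≤ κ →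
      ∃ (T : ℝ) (X : Fin m → ℤ → ℝ → ℝ), 0 < T ∧
        (∀ i n, ContDiffOn ℝ 1 (X i n) (Set.Ico 0 T)) ∧
        (∀ i n, X i n 0 = if n = 0 then X₀ i else 0) ∧
        (∀ i n t, n < 0 → X i n t = 0) ∧
        (∀ i n t, 0 ≤ t → t < T → derivWithin (X i n) (Set.Ici 0) t =
          quadTerm ε₀ α X i n t - ν * (1 + ε₀) ^ ((2 : ℝ) * n) * X i n t) ∧
        (∀ t ∈ Ico (0 : ℝ) T, ∀ (i : Fin m) (k : ℤ), |X i k t| ≤ Real.sqrt (∑ j, X₀ j ^ 2)) ∧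
        (∀ (K : ℤ) (L : ℝ), ∃ t : ℝ, 0 ≤ t ∧ t < T ∧
          ∃ (i : Fin m) (k : ℤ), K < k ∧ L < (1 + (1 + ε₀) ^ ((10 : ℝ) * k)) * |X i k t|) := by
  obtain ⟨κ, hκ, H⟩ := maximalViscousFlow_of_noGlobalCascade hε hα hNG
  refine ⟨κ, hκ, fun ν hν hνκ => ?_⟩
  obtain ⟨T, X, hT, h1, h2, h3, h4, h5, h6⟩ := H ν hν hνκ
  have hl1 : (1 : ℝ) ≤ 1 + ε₀ := by linarith
  have hder : ∀ i k, ∀ τ ∈ Ico (0 : ℝ) T, HasDerivWithinAt (X i k)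
      (quadTerm ε₀ α X i k τ - ν * (1 + ε₀) ^ ((2 : ℝ) * k) * X i k τ) (Ici 0) τ := by
    intro i k τ hτ
    have hd : DifferentiableWithinAt ℝ (X i k) (Ico 0 T) τ :=
      ((h1 i k).differentiableOn one_ne_zero) τ hτ
    have hd' : DifferentiableWithinAt ℝ (X i k) (Ici 0) τ :=
      hd.mono_of_mem_nhdsWithin (by
        rw [mem_nhdsWithin]
        exact ⟨Iio T, isOpen_Iio, hτ.2, fun x hx => ⟨hx.2, hx.1⟩⟩)
    rw [← h4 i k τ hτ.1 hτ.2]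
    exact hd'.hasDerivWithinAt
  have hreg : ∀ T' : ℝ, T' < T → ∃ M : ℝ, ∀ τ ∈ Icc (0 : ℝ) T', ∀ (i : Fin m) (k : ℤ),
      (1 + (1 + ε₀) ^ ((10 : ℝ) * k)) * |X i k τ| ≤ M := by
    intro T' hT'
    rcases le_or_gt T' 0 with h0 | h0
    · obtain ⟨M, hM⟩ := h5 (T / 2) (by linarith) (by linarith)
      exact ⟨M, fun τ hτ i k => hM τ hτ.1 (by linarith [hτ.2]) i k⟩
    · obtain ⟨M, hM⟩ := h5 T' h0 hT'
      exact ⟨M, fun τ hτ i k => hM τ hτ.1 hτ.2 i k⟩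
  have hamp := viscous_abs_le_datumNorm hε hν hα.2.1 hder h2 h3 hreg
  refine ⟨T, X, hT, h1, h2, h3, h4, hamp, fun K L => ?_⟩
  set D : ℝ := Real.sqrt (∑ j, X₀ j ^ 2) with hDdef
  have hD0 : 0 ≤ D := Real.sqrt_nonneg _
  obtain ⟨t, ht0, htT, i, k, hlt⟩ := h6 (max L ((1 + (1 + ε₀) ^ ((10 : ℝ) * K)) * D))
  refine ⟨t, ht0, htT, i, k, ?_, lt_of_le_of_lt (le_max_left _ _) hlt⟩
  by_contra hkK
  have hkK : k ≤ K := not_lt.1 hkK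
  have hpow : (1 + ε₀) ^ ((10 : ℝ) * k) ≤ (1 + ε₀) ^ ((10 : ℝ) * K) := by
    refine Real.rpow_le_rpow_of_exponent_le hl1 ?_
    have : (k : ℝ) ≤ K := by exact_mod_cast hkK
    linarith
  have hW0 : 0 ≤ 1 + (1 + ε₀) ^ ((10 : ℝ) * K) := by
    have := Real.rpow_nonneg (by linarith : (0 : ℝ) ≤ 1 + ε₀) ((10 : ℝ) * K); linarith
  have hle : (1 + (1 + ε₀) ^ ((10 : ℝ) * k)) * |X i k t| ≤ (1 + (1 + ε₀) ^ ((10 : ℝ) * K)) * D :=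
    mul_le_mul (by linarith) (hamp t ⟨ht0, htT⟩ i k) (abs_nonneg _) hW0
  exact absurd (lt_of_le_of_lt (le_max_right _ _) hlt) (not_lt.2 hle)

end BlowupRigidityOne

end Summit.NavierStokesRegularity.NavierStokesRegularity.Theorems

end
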